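import Summits.HubbardSuperconductivity.HubbardSuperconductivity.Theorems.AnisotropyChordTransferFibre3TwoHoleBS
import Summits.HubbardSuperconductivity.HubbardSuperconductivity.Theorems.AnisotropyChordTransferFibre3TwoChannel

/-!
# Route `AnisotropyChord` / H0 rotor rung: PROP BS meets PartN40 — for disjoint crosses the HOLE₂ certificate IS `twoHoleP A Λ̃ ⪰ 0` (Sherman–Morrison)

Third file of PROP BS (memo ROTOR-THEORY-21 §314(a), §318, §324; theory seat `hubbard-h0-rotor-theory-1`).  `…Fibre3TwoHoleBS`
reduces `TwoHoleGap L g` to a `10 × 10` matrix certificate per pair (`MatrixCert`, charge map `E`, Green matrix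
`G̃_DD`).  PartN40 (`…Fibre3TwoChannel`, p2 g0's port; all targets proved: `twoChannelReduction_holds`, `oneHoleSkeleton_holds`,
`compressionBound_holds`, `capacityShift_of_isSymm`) is phrased with the POSITIVITY MAP
`twoHoleP A Λ = −(A⁻¹)_BB − ½ + [Λ/(Λs − 1)] x_B x_Bᵀ` of a kernel matrix `A` on `Fin 5 ⊕ Fin 5`.  This file identifies the two:
* `kerMat` (`A_{pq} = a_L(pt p − pt q)`, `a_L = 2·aKer L (2g)` = walk kernel), `capT` (`Λ̃ = G̃_g(0) = 2·Gres L (2g) 0`, zero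
  mode removed), `greenMat_eq`: `G̃_DD = Λ̃·11ᵀ − A`; `kerMat_isSymm`;
* `smInv`, ★ `capJ_sub_mul_smInv` — SHERMAN–MORRISON: `(Λ·11ᵀ − A)(−A⁻¹ + [Λ/(Λs−1)] x xᵀ) = 1` for symmetric invertible `A`,
  `Λs ≠ 1` (`x = A⁻¹1 = xvec2 A`, `s = svec2 A`);
* ★ `matrixCert_of_twoHoleP` / `dualCert_of_twoHoleP`: if `A` is invertible, `Λ̃s ≠ 1` and `twoHoleP A Λ̃ ⪰ 0` (real quadratic
  form on `Fin 4 ⊕ Fin 4`), the pair has a matrix / dual certificate — so for every pair with disjoint crosses the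
  two-channel theorem acts directly on a sufficient condition for `TwoHoleGap` (`twoHoleGap_of_dualCert`).
Remarks. (i) `A` invertible forces the ten points to be distinct (disjoint crosses, `|d|∞ ≥ 2` and `d ∉ {(±2,0),(0,±2),(±1,±1)}`…: exactly
the far/mid pairs of §318/§324); near pairs use `MatrixCert` with multiplicities.  (ii) The capacity here is `Λ̃ = G̃(0)` (zero mode
removed); the memo's `Λ_full = Λ̃ − 2/(λV)` enters an equivalent criterion — for the sufficiency direction only `Λ̃` is needed, and
`twoHoleP A ·` is Loewner-DEcreasing in the capacity (`capacity_decomposition`), so a certificate at any `Λ ≤ Λ̃` with `Λs > 1` also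
serves.
Prover seat `hubbard-h0-rotor-p2` g2; helper for stmt-HubbardSuperconductivity-19089 (`--supports`, helper class).
WHAT THIS IS NOT: nothing here proves superconductivity in the Hubbard model; the rotor TARGET as originally worded stays
FALSE (g15 verdict).  Finite matrix algebra behind ONE input (HOLE₂) of ONE conditional reduction (rung 19089); it certifies no
pair by itself.  Mathlib + tree imports only; no sorry, no axioms.
-/

set_option linter.dupNamespace false

noncomputable section

open scoped BigOperators
open Complex Finset

namespace Summit.HubbardSuperconductivity.HubbardSuperconductivity.Theorems.AnisotropyChord.Transfer.Fibre3

namespace TwoHoleBS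

variable (L : ℕ) [NeZero L]

/-! ## The link to PartN40: for disjoint crosses the certificate is `twoHoleP A Λ̃ ⪰ 0` (Sherman–Morrison) -/

/-- walk-kernel matrix of the pair on the ten points, `A_{pq} = a_L(pt p − pt q)`, `a_L = 2·aKer L (2g)` (walk units). [folklore] -/
def kerMat (g : ℝ) (z₁ z₂ : Tor L) : Matrix (Fin 5 ⊕ Fin 5) (Fin 5 ⊕ Fin 5) ℝ :=
  Matrix.of fun p q => 2 * aKer L (2 * g) (bsPt L z₁ z₂ p - bsPt L z₁ z₂ q)

/-- capacity with the zero mode removed, `Λ̃ = G̃_g(0) = 2·Gres L (2g) 0` (walk units; the memo's `Λ_full` is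
`Λ̃ − 2/(2g·V)`). [folklore] -/
def capT (g : ℝ) : ℝ := 2 * Gres L (2 * g) 0

/-- the all-ones `10 × 10` matrix. [folklore] -/
def J10 : Matrix (Fin 5 ⊕ Fin 5) (Fin 5 ⊕ Fin 5) ℝ := Matrix.of fun _ _ => 1

/-- Sherman–Morrison inverse of `Λ·11ᵀ − A`: `−A⁻¹ + [Λ/(Λs − 1)]·x xᵀ`, `x = A⁻¹1`, `s = Σx` (PartN40's `xvec2`, `svec2`). [folklore] -/
def smInv (A : Matrix (Fin 5 ⊕ Fin 5) (Fin 5 ⊕ Fin 5) ℝ) (Λ : ℝ) : Matrix (Fin 5 ⊕ Fin 5) (Fin 5 ⊕ Fin 5) ℝ :=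
  -A⁻¹ + (Λ / (Λ * TwoChannel.svec2 A - 1)) • Matrix.vecMulVec (TwoChannel.xvec2 A) (TwoChannel.xvec2 A)

/-- the Green matrix is `Λ̃·11ᵀ − A` (real). [folklore] -/
theorem greenMat_eq (g : ℝ) (z₁ z₂ : Tor L) :
    greenMat L g z₁ z₂ = (capT L g • J10 - kerMat L g z₁ z₂).map Complex.ofReal := by
  ext p q
  simp only [greenMat, kerMat, capT, J10, Matrix.map_apply, Matrix.sub_apply, Matrix.smul_apply, Matrix.of_apply,
    smul_eq_mul, mul_one]
  apply Complex.ext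
  · rw [Complex.ofReal_re, greenW_re]; unfold aKer; ring
  · rw [Complex.ofReal_im, greenW_im]

/-- `A x = 1` for `x = A⁻¹1`. [folklore] -/
theorem mulVec_xvec2 (A : Matrix (Fin 5 ⊕ Fin 5) (Fin 5 ⊕ Fin 5) ℝ) (hA : IsUnit A.det) :
    A.mulVec (TwoChannel.xvec2 A) = fun _ => 1 := by
  unfold TwoChannel.xvec2
  rw [Matrix.mulVec_mulVec, Matrix.mul_nonsing_inv _ hA, Matrix.one_mulVec]

/-- for symmetric `A`: `1ᵀA⁻¹ = xᵀ`. [folklore] -/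
theorem one_vecMul_inv (A : Matrix (Fin 5 ⊕ Fin 5) (Fin 5 ⊕ Fin 5) ℝ) (hs : A.IsSymm) :
    Matrix.vecMul (fun _ => (1 : ℝ)) A⁻¹ = TwoChannel.xvec2 A := by
  have h : (A⁻¹).IsSymm := by
    unfold Matrix.IsSymm at *
    rw [Matrix.transpose_nonsing_inv, hs]
  rw [← Matrix.mulVec_transpose, h.eq]
  rfl

/-- SHERMAN–MORRISON: `(Λ·11ᵀ − A)·(−A⁻¹ + [Λ/(Λs−1)] x xᵀ) = 1` for symmetric invertible `A` with `Λs ≠ 1`. [folklore] -/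
theorem capJ_sub_mul_smInv (A : Matrix (Fin 5 ⊕ Fin 5) (Fin 5 ⊕ Fin 5) ℝ) (hs : A.IsSymm) (hA : IsUnit A.det)
    (Λ : ℝ) (h : Λ * TwoChannel.svec2 A - 1 ≠ 0) :
    (Λ • J10 - A) * smInv A Λ = 1 := by
  have hx := mulVec_xvec2 A hA
  have hcol := one_vecMul_inv A hs
  have hsdef : dotProduct (fun _ => (1 : ℝ)) (TwoChannel.xvec2 A) = TwoChannel.svec2 A := by
    simp [dotProduct, TwoChannel.svec2]
  have hJ : J10 = Matrix.vecMulVec (fun _ => (1 : ℝ)) (fun _ => (1 : ℝ)) := by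
    ext i j; simp [J10, Matrix.vecMulVec_apply]
  unfold smInv
  rw [hJ, Matrix.sub_mul, Matrix.mul_add, Matrix.mul_add, Matrix.mul_neg, Matrix.mul_neg,
    Matrix.mul_nonsing_inv _ hA, Matrix.mul_smul, Matrix.mul_smul, Matrix.smul_mul, Matrix.smul_mul,
    Matrix.vecMulVec_mul, hcol, Matrix.vecMulVec_mul_vecMulVec, hsdef, Matrix.mul_vecMulVec, hx]
  ext i j
  simp only [Matrix.sub_apply, Matrix.add_apply, Matrix.neg_apply, Matrix.smul_apply, Matrix.vecMulVec_apply,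
    Pi.smul_apply, smul_eq_mul, Matrix.one_apply]
  field_simp
  ring

/-- the kernel matrix is symmetric (`a(−r) = a(r)`). [folklore] -/
theorem kerMat_isSymm (g : ℝ) (z₁ z₂ : Tor L) : (kerMat L g z₁ z₂).IsSymm := by
  ext p q
  simp only [kerMat, Matrix.transpose_apply, Matrix.of_apply]
  unfold aKer
  rw [← neg_sub (bsPt L z₁ z₂ p), Gres_neg]

/-- a sum over the ten slots of a function vanishing on the two centre slots is the sum over PartN40's boundary
embedding `emb : Fin 4 ⊕ Fin 4 → Fin 5 ⊕ Fin 5`. [folklore] -/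
theorem sum_eq_sum_emb {F : Fin 5 ⊕ Fin 5 → ℂ} (h1 : F (Sum.inl 0) = 0) (h2 : F (Sum.inr 0) = 0) :
    ∑ p : Fin 5 ⊕ Fin 5, F p = ∑ i : Fin 4 ⊕ Fin 4, F (TwoChannel.emb i) := by
  have hl : ∑ j : Fin 5, F (Sum.inl j) = ∑ i : Fin 4, F (Sum.inl i.succ) := by
    rw [Fin.sum_univ_succ, h1, zero_add]
  have hr : ∑ j : Fin 5, F (Sum.inr j) = ∑ i : Fin 4, F (Sum.inr i.succ) := by
    rw [Fin.sum_univ_succ, h2, zero_add]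
  rw [Fintype.sum_sum_type, Fintype.sum_sum_type, hl, hr]
  rfl

/-- **for disjoint crosses the matrix certificate IS PartN40's two-hole map:** if the kernel matrix `A = (a_L(p − q))` of
the pair is invertible, `Λ̃s ≠ 1`, and `twoHoleP A Λ̃ ⪰ 0` (as a real quadratic form), then `MatrixCert` holds with the
Sherman–Morrison charge map `E = −A⁻¹ + [Λ̃/(Λ̃s−1)] x xᵀ` — so `TwoChannelReduction` / `OneHoleSkeleton` /
`CompressionBound` (all proved) act directly on a sufficient condition for `TwoHoleGap`. [folklore] -/
theorem matrixCert_of_twoHoleP (g : ℝ) (z₁ z₂ : Tor L)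
    (hA : IsUnit (kerMat L g z₁ z₂).det) (hΛ : capT L g * TwoChannel.svec2 (kerMat L g z₁ z₂) - 1 ≠ 0)
    (hP : ∀ v : Fin 4 ⊕ Fin 4 → ℝ,
      0 ≤ dotProduct v ((TwoChannel.twoHoleP (kerMat L g z₁ z₂) (capT L g)).mulVec v)) :
    MatrixCert L g z₁ z₂ ((smInv (kerMat L g z₁ z₂) (capT L g)).map Complex.ofReal) := by
  set A := kerMat L g z₁ z₂ with hAdef
  set Λ := capT L g with hΛdef
  set E := smInv A Λ with hEdef
  apply matrixCert_of_inverse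
  · have hprod := capJ_sub_mul_smInv A (kerMat_isSymm L g z₁ z₂) hA Λ hΛ
    rw [greenMat_eq, ← hAdef, ← hΛdef]
    change (Λ • J10 - A).map (Complex.ofRealHom : ℝ →+* ℂ) * E.map (Complex.ofRealHom : ℝ →+* ℂ) = 1
    rw [← Matrix.map_mul, hprod, Matrix.map_one _ (map_zero _) (map_one _)]
  · intro φ h1 h2
    set ψ := restr L z₁ z₂ φ with hψ
    have hψ1 : ψ (Sum.inl 0) = 0 := by simp [hψ, restr, bsPt, clusterPt, h1]
    have hψ2 : ψ (Sum.inr 0) = 0 := by simp [hψ, restr, bsPt, clusterPt, h2]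
    -- real and imaginary parts of the boundary data
    set u : Fin 4 ⊕ Fin 4 → ℝ := fun i => (ψ (TwoChannel.emb i)).re with hu
    set v : Fin 4 ⊕ Fin 4 → ℝ := fun i => (ψ (TwoChannel.emb i)).im with hv
    -- E on the boundary block is `twoHoleP + ½`
    have hE : ∀ i j : Fin 4 ⊕ Fin 4, E (TwoChannel.emb i) (TwoChannel.emb j)
        = TwoChannel.twoHoleP A Λ i j + (if i = j then (1 : ℝ) / 2 else 0) := by
      intro i j
      simp only [hEdef, smInv, TwoChannel.twoHoleP, Matrix.add_apply, Matrix.neg_apply, Matrix.smul_apply,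
        Matrix.vecMulVec_apply, Matrix.of_apply, smul_eq_mul]
      ring
    -- the quadratic form, restricted to the boundary slots and split into real/imaginary parts
    have hlhs : ∑ p : Fin 5 ⊕ Fin 5, ‖ψ p‖ ^ 2 = ∑ i : Fin 4 ⊕ Fin 4, (u i ^ 2 + v i ^ 2) := by
      have := sum_eq_sum_emb (F := fun p => ((‖ψ p‖ ^ 2 : ℝ) : ℂ)) (by simp [hψ1]) (by simp [hψ2])
      have h' : ∀ i : Fin 4 ⊕ Fin 4, ((‖ψ (TwoChannel.emb i)‖ ^ 2 : ℝ) : ℂ) = ((u i ^ 2 + v i ^ 2 : ℝ) : ℂ) := by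
        intro i; rw [Complex.sq_norm, Complex.normSq_apply]; push_cast; ring
      simp_rw [h'] at this
      exact_mod_cast this
    have hrhs : (∑ p : Fin 5 ⊕ Fin 5, (starRingEnd ℂ) (ψ p) * (E.map Complex.ofReal).mulVec ψ p).re
        = ∑ i : Fin 4 ⊕ Fin 4, ∑ j : Fin 4 ⊕ Fin 4,
            E (TwoChannel.emb i) (TwoChannel.emb j) * (u i * u j + v i * v j) := by
      have hmv : ∀ p : Fin 5 ⊕ Fin 5, (E.map Complex.ofReal).mulVec ψ p
          = ∑ j : Fin 4 ⊕ Fin 4, ((E p (TwoChannel.emb j) : ℝ) : ℂ) * ψ (TwoChannel.emb j) := by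
        intro p
        change ∑ q : Fin 5 ⊕ Fin 5, (E.map Complex.ofReal) p q * ψ q = _
        rw [sum_eq_sum_emb (F := fun q => (E.map Complex.ofReal) p q * ψ q) (by simp [hψ1]) (by simp [hψ2])]
        rfl
      simp_rw [hmv]
      rw [sum_eq_sum_emb (F := fun p => (starRingEnd ℂ) (ψ p) *
          ∑ j : Fin 4 ⊕ Fin 4, ((E p (TwoChannel.emb j) : ℝ) : ℂ) * ψ (TwoChannel.emb j))
          (by simp [hψ1]) (by simp [hψ2])]
      rw [Complex.re_sum]
      refine Finset.sum_congr rfl fun i _ => ?_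
      rw [Finset.mul_sum, Complex.re_sum]
      refine Finset.sum_congr rfl fun j _ => ?_
      simp only [Complex.mul_re, Complex.mul_im, Complex.conj_re, Complex.conj_im, Complex.ofReal_re,
        Complex.ofReal_im, hu, hv, zero_mul, sub_zero, add_zero]
      ring
    rw [hlhs, hrhs]
    simp_rw [hE, add_mul, Finset.sum_add_distrib]
    have hPu := hP u
    have hPv := hP v
    simp only [dotProduct, Matrix.mulVec] at hPu hPv
    have hdiag : ∑ i : Fin 4 ⊕ Fin 4, ∑ j : Fin 4 ⊕ Fin 4,
        (if i = j then (1 : ℝ) / 2 else 0) * (u i * u j + v i * v j)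
        = (1 / 2 : ℝ) * ∑ i : Fin 4 ⊕ Fin 4, (u i ^ 2 + v i ^ 2) := by
      simp_rw [ite_mul, zero_mul, Finset.sum_ite_eq, Finset.mem_univ, if_true, Finset.mul_sum]
      refine Finset.sum_congr rfl fun i _ => ?_
      ring
    rw [hdiag]
    have hsplit : ∑ i : Fin 4 ⊕ Fin 4, ∑ j : Fin 4 ⊕ Fin 4,
        TwoChannel.twoHoleP A Λ i j * (u i * u j + v i * v j)
        = (∑ i : Fin 4 ⊕ Fin 4, u i * ∑ j : Fin 4 ⊕ Fin 4, TwoChannel.twoHoleP A Λ i j * u j)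
          + ∑ i : Fin 4 ⊕ Fin 4, v i * ∑ j : Fin 4 ⊕ Fin 4, TwoChannel.twoHoleP A Λ i j * v j := by
      rw [← Finset.sum_add_distrib]
      refine Finset.sum_congr rfl fun i _ => ?_
      rw [Finset.mul_sum, Finset.mul_sum, ← Finset.sum_add_distrib]
      refine Finset.sum_congr rfl fun j _ => ?_
      ring
    rw [hsplit]
    have hs2 : ∑ i : Fin 4 ⊕ Fin 4, (u i ^ 2 + v i ^ 2)
        = ∑ i : Fin 4 ⊕ Fin 4, u i ^ 2 + ∑ i : Fin 4 ⊕ Fin 4, v i ^ 2 := Finset.sum_add_distrib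
    linarith [hPu, hPv, hs2]

/-- **HOLE₂ from PartN40-type data, per pair:** the dual certificate of a pair with invertible kernel matrix follows from
`twoHoleP A Λ̃ ⪰ 0`. [folklore] -/
theorem dualCert_of_twoHoleP (g : ℝ) (z₁ z₂ : Tor L)
    (hA : IsUnit (kerMat L g z₁ z₂).det) (hΛ : capT L g * TwoChannel.svec2 (kerMat L g z₁ z₂) - 1 ≠ 0)
    (hP : ∀ v : Fin 4 ⊕ Fin 4 → ℝ,
      0 ≤ dotProduct v ((TwoChannel.twoHoleP (kerMat L g z₁ z₂) (capT L g)).mulVec v)) :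
    DualCert L g z₁ z₂ :=
  dualCert_of_matrixCert L (matrixCert_of_twoHoleP L g z₁ z₂ hA hΛ hP)

end TwoHoleBS

end Summit.HubbardSuperconductivity.HubbardSuperconductivity.Theorems.AnisotropyChord.Transfer.Fibre3

end
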